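import Mathlib
import Literature.NumberTheory.LFunctions.Zhang2022.Section7SjPolylog
import Literature.NumberTheory.LFunctions.Zhang2022.AppendixAXiZeroMult
import HarnessLib

/-!
# Zhang (2022) §7 p. 33 / §11 p. 64: the TRUE-SIZE logarithmic mean of `ξ₀ⱼ(n;d,r)` —
# `Σ_{n≤X} |ξ₀ⱼ(n;d,r)|/n ≪ 2^{ω(r)} log X`

Topic `Literature/NumberTheory/LFunctions/Zhang2022` (Landau–Siegel audit tree; verdict-neutral).
Y. Zhang, *Discrete mean estimates and the Landau–Siegel zero*, arXiv:2211.02515v1 (2022)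
[Zhang2022LandauSiegel], §7 p. 33 (the objects `κ`, `κ̃₀ⱼ`, `λ₀ⱼ`, `λ̃₀ⱼ`, `ξ₀ⱼ(n;d,r)` of
Proposition 7.1) and §11 p. 64 (tex L3298–L3301: "By (11.3), (8.25) and (8.26), …" — the window
mean square `Z22:§11.u019`, typed `Typed.TypedSection11B.Step11u019`, GAP row G-L3t10-1; the
displays (8.25)/(8.26) do not exist in v1) — **an unrefereed manuscript under adjudication;
nothing here asserts or denies its Theorems 1–2.** ZHANG-L discharge lane, WP11 (helper H3).

The window mean square was reduced in the kernel (`Section11WindowMeanSquare`, zl-libB-p3) to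
"`𝓛⁹·S_j(𝐚,𝐚̄) → 0`" for the window sequence `𝐚`; every absolute-value treatment of
`S_j(𝐚₁,𝐚₂) = Σ_dΣ_r |μ(r)|λ₀ⱼ(dr)/(drφ(r))(Σ_m …)(Σ_n a₂(drn)ξ₀ⱼ(n;d,r)/n)` needs the
logarithmic mean `Σ_n |ξ₀ⱼ(n;d,r)|/n`. The tree's majorants bound the two terms `k ∌ q`, `k ∋ q`
of the inner Möbius sum of `ξ₀ⱼ(q;d,r)` SEPARATELY (`gC(q) ≤ 5`, `Section7SjPolylog`; `gMaj(q) ≤ 3`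
for `B log q ≤ 1/8`, `Section8XiZeroTailMean`), giving `(log X)⁵` resp. `(log X)³`. THIS FILE uses
the EXACT prime-power values of `ξ₀ⱼ` (tree theorems of WP09, `AppendixALemma83Local`:
`Lemma83.xiZero_prime_pow_of_coprime / of_dvd_left / of_dvd_right`, and the multiplicativity
`Lemma83.xiZero_mul_of_coprime` of `AppendixAXiZeroMult`) and the cancellation inside the local
factor,
`κ(q) − q^{1−β_j}/(q−1) = Σ_i (q^{−β_i} − 1) − (q^{−β_j} − 1)·q/(q−1) + (1 − 1/(q−1))`,
to get the true size at the primes: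

* `norm_xiZero_prime_le_of_not_dvd` — **`|ξ₀ⱼ(q;d,r)| ≤ 1 + 21·B·log q + M_x/q`** for `q ∤ r`
  (`B = |b₁|+|b₂|+|b₃|`, `M_x = 12 + 56S₃` written out), and `|ξ₀ⱼ(q;d,r)| = |κ(q)| ≤ 2 + B log q`
  for `q ∣ r` (`norm_xiZero_prime_le_of_dvd`);
* `sum_norm_xiZero_div_le_trueSize` — for all `c′, D, j`, `d, r ≥ 1`, `X ≥ 2`:
  **`Σ_{n≤X} |ξ₀ⱼ(n;d,r)|/n ≤ 2^{ω(r)}·exp(4 + 21B·log(4X) + M_x + 7(2+S₃)S₄)·log X`**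
  (`XiZeroMajorant.sum_div_le_gen` with `a = 1` applied to the multiplicative function
  `|ξ₀ⱼ(n;d,r)|/2^{#{q ∣ (n,r)}}`; log-mean EXPONENT ONE, uniformly in `d, r, j`);
* `sum_norm_xiZero_div_le_ell9` — for `D ≥ ⌈exp(5|c′|π+3)⌉` (`B ≤ 9π𝓛⁻⁹`,
  `three_le_ell_and_Bsum_le`) and `2 ≤ X ≤ 4P`: `Σ_{n≤X} |ξ₀ⱼ(n;d,r)|/n ≤ K_x·2^{ω(r)}·𝓛⁹` with the
  absolute constant `K_x = 3·exp(4 + 1134π + M_x + 7(2+S₃)S₄)` (written out).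

Consistency with the manuscript: (8.10)/Lemma 8.3 (`Σ_n χ(n)ξ₀ⱼ(n;d,r)n^{−s} =
L(s+β_{j+1},χ)L(s+β_{j+2},χ)L(s,χ)⁻¹·𝔲_j(d,r;s)`), i.e. `ξ₀ⱼ ≈ 1_{β_{j+1}} ∗ 1_{β_{j+2}} ∗ μ`, whose
value at a small prime is `q^{−β_{j+1}} + q^{−β_{j+2}} − 1 ≈ 1`.

Theorems only: 0 definitions, 0 facts, standard axioms (the halved majorant is a local `set` inside
the proof of `sum_norm_xiZero_div_le_trueSize`; the count `omegaR` of common prime factors is written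
out as `(n.primeFactors.filter (· ∣ r)).card`). No statement about Landau–Siegel zeros is made or
implied.

## References

* Y. Zhang, arXiv:2211.02515v1 (2022), §7 p. 33 (Prop. 7.1), §8 (8.10), §11 p. 64,
  App. A pp. 101–103. [cite: Zhang2022LandauSiegel, §7 p.33; §11 p.64; App. A pp.101–103]
* R. R. Hall, G. Tenenbaum, *Divisors* (CUP 1988), (0.4). [cite: HallTenenbaum1988, (0.4)]
-/

noncomputable section

open Finset Real ArithmeticFunction

namespace Literature.NumberTheory.LFunctions.Zhang2022.XiZeroMajorant

open MeanSquareMajorant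

variable (c' : ℝ) (D : ℕ)

/-! ### Part 1. `κ` and `q^{1−β_j}` at a prime -/

/-- `κ(q) = q^{−β₁} + q^{−β₂} + q^{−β₃} − 1` for Zhang's `κ = Skeleton.kappaZ c′ D` at a prime `q`.
[cite: Zhang2022LandauSiegel, §7 p.33] -/
theorem kappaZ_prime {q : ℕ} (hq : q.Prime) :
    Skeleton.kappaZ c' D q = powI (Skeleton.b1 c' D) q + powI (Skeleton.b2 c' D) q +
      powI (Skeleton.b3 c' D) q - 1 := by
  rw [Skeleton.kappaZ]; exact kappa_apply_prime _ _ _ hq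

/-- `‖κ(q)‖ ≤ 2 + B log q` at a prime (`B = |b₁|+|b₂|+|b₃|`). [cite: Zhang2022LandauSiegel, §7 p.33] -/
theorem norm_kappaZ_prime_le {q : ℕ} (hq : q.Prime) :
    ‖Skeleton.kappaZ c' D q‖ ≤ 2 + Bsum c' D * Real.log q := by
  rw [Skeleton.kappaZ, Bsum]; exact norm_kappa_prime_le _ _ _ hq

/-- `q^{1−β_j} = q·q^{−β_j} = q·powI(b_j)(q)` for `q ≥ 1`. [cite: Zhang2022LandauSiegel, §7 p.33] -/
theorem natCast_cpow_one_sub_betaJ {q : ℕ} (hq : q ≠ 0) (j : ℕ) :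
    (q : ℂ) ^ (1 - Skeleton.betaJ c' D j) = (q : ℂ) * powI (bJ c' D j) q := by
  have hq' : (q : ℂ) ≠ 0 := by exact_mod_cast hq
  rw [powI_apply_of_ne_zero _ hq, betaJ_eq, sub_eq_add_neg, Complex.cpow_add _ _ hq',
    Complex.cpow_one]

/-- `‖q^{1−β_j}‖ = q`. [cite: Zhang2022LandauSiegel, §7 p.33] -/
theorem norm_natCast_cpow_one_sub_betaJ {q : ℕ} (hq : 0 < q) (j : ℕ) :
    ‖(q : ℂ) ^ (1 - Skeleton.betaJ c' D j)‖ = q := by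
  rw [Complex.norm_natCast_cpow_of_pos hq, one_sub_betaJ_re, Real.rpow_one]

/-! ### Part 2. The cancellation inside the local factor at a prime -/

/-- **The local cancellation.** For a prime `q` and any `j`:
`‖κ(q) − κ(1)·q^{1−β_j}/(q−1)‖ ≤ 1 + 3B log q` — indeed
`κ(q) − q^{1−β_j}/(q−1) = Σ_i(q^{−β_i} − 1) − (q^{−β_j} − 1)q/(q−1) + (1 − 1/(q−1))` with
`|q^{−ib} − 1| ≤ |b| log q`, `q/(q−1) ≤ 2`, `0 ≤ 1 − 1/(q−1) ≤ 1`. This is the `μ(k)`-cancellation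
between the divisors `k ∌ q` and `k ∋ q` of the inner sum of `ξ₀ⱼ(q;d,r)`.
[cite: Zhang2022LandauSiegel, §7 p.33; App. A p.102] -/
theorem norm_kappaZ_sub_pole_le {q : ℕ} (hq : q.Prime) (j : ℕ) :
    ‖Skeleton.kappaZ c' D q -
        Skeleton.kappaZ c' D (q ^ 0) * (q : ℂ) ^ (1 - Skeleton.betaJ c' D j) / ((q : ℂ) - 1)‖ ≤
      1 + 3 * Bsum c' D * Real.log q := by
  have hq2 : (2 : ℝ) ≤ q := by exact_mod_cast hq.two_le
  have hq1 : (q : ℂ) - 1 ≠ 0 := by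
    have : (1 : ℝ) < q := by linarith
    intro h
    have h' : (q : ℂ) = 1 := sub_eq_zero.mp h
    have : (q : ℝ) = 1 := by exact_mod_cast (by exact_mod_cast h' : (q : ℂ) = ((1 : ℕ) : ℂ))
    linarith
  set z₁ := powI (Skeleton.b1 c' D) q with hz₁
  set z₂ := powI (Skeleton.b2 c' D) q with hz₂
  set z₃ := powI (Skeleton.b3 c' D) q with hz₃
  set w := powI (bJ c' D j) q with hw
  set t : ℂ := (q : ℂ) / ((q : ℂ) - 1) with ht
  have hκ1 : Skeleton.kappaZ c' D (q ^ 0) = 1 := by rw [pow_zero]; exact Lemma83.kappaZ_one c' D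
  have hexp : Skeleton.kappaZ c' D q -
      Skeleton.kappaZ c' D (q ^ 0) * (q : ℂ) ^ (1 - Skeleton.betaJ c' D j) / ((q : ℂ) - 1) =
      (z₁ - 1) + (z₂ - 1) + (z₃ - 1) - (w - 1) * t + (1 - (t - 1)) := by
    rw [kappaZ_prime c' D hq, hκ1, natCast_cpow_one_sub_betaJ c' D hq.ne_zero j, one_mul]
    simp only [ht, hz₁, hz₂, hz₃, hw]
    field_simp
    ring
  have hlog0 : 0 ≤ Real.log q := Real.log_nonneg (by linarith)
  have hB := Bsum_nonneg c' D
  -- the real number `t = q/(q-1)` : `1 ≤ t ≤ 2`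
  have hqR1 : (0 : ℝ) < (q : ℝ) - 1 := by linarith
  have htR : t = (((q : ℝ) / ((q : ℝ) - 1) : ℝ) : ℂ) := by
    rw [ht]; push_cast; rfl
  have ht_le : (q : ℝ) / ((q : ℝ) - 1) ≤ 2 := by
    rw [div_le_iff₀ hqR1]; linarith
  have ht_ge : 1 ≤ (q : ℝ) / ((q : ℝ) - 1) := by
    rw [le_div_iff₀ hqR1]; linarith
  have hnt : ‖t‖ ≤ 2 := by
    rw [htR, Complex.norm_real, Real.norm_eq_abs, abs_of_nonneg (by linarith)]; exact ht_le
  have hn1t : ‖(1 : ℂ) - (t - 1)‖ ≤ 1 := by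
    have e : (1 : ℂ) - (t - 1) = (((2 - (q : ℝ) / ((q : ℝ) - 1) : ℝ)) : ℂ) := by
      rw [htR]; push_cast; ring
    rw [e, Complex.norm_real, Real.norm_eq_abs, abs_le]
    constructor <;> linarith
  have h1 := norm_powI_sub_one_le (Skeleton.b1 c' D) hq.pos
  have h2 := norm_powI_sub_one_le (Skeleton.b2 c' D) hq.pos
  have h3 := norm_powI_sub_one_le (Skeleton.b3 c' D) hq.pos
  have hwb := norm_powI_sub_one_le (bJ c' D j) hq.pos
  have hbJ := abs_bJ_le c' D j
  have hwt : ‖(w - 1) * t‖ ≤ 2 * (Bsum c' D * Real.log q) := by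
    rw [norm_mul]
    calc ‖w - 1‖ * ‖t‖ ≤ (|bJ c' D j| * Real.log q) * 2 :=
          mul_le_mul hwb hnt (norm_nonneg _) (by positivity)
      _ ≤ (Bsum c' D * Real.log q) * 2 := by gcongr
      _ = _ := by ring
  rw [hexp]
  calc ‖(z₁ - 1) + (z₂ - 1) + (z₃ - 1) - (w - 1) * t + (1 - (t - 1))‖
      ≤ ‖(z₁ - 1) + (z₂ - 1) + (z₃ - 1) - (w - 1) * t‖ + ‖(1 : ℂ) - (t - 1)‖ := norm_add_le _ _
    _ ≤ (‖(z₁ - 1) + (z₂ - 1) + (z₃ - 1)‖ + ‖(w - 1) * t‖) + 1 := by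
        gcongr; exact norm_sub_le _ _
    _ ≤ (‖z₁ - 1‖ + ‖z₂ - 1‖ + ‖z₃ - 1‖ + ‖(w - 1) * t‖) + 1 := by
        gcongr; exact norm_add₃_le
    _ ≤ (|Skeleton.b1 c' D| * Real.log q + |Skeleton.b2 c' D| * Real.log q +
          |Skeleton.b3 c' D| * Real.log q + 2 * (Bsum c' D * Real.log q)) + 1 := by
        gcongr
    _ = 1 + 3 * Bsum c' D * Real.log q := by rw [Bsum]; ring

/-! ### Part 3. The tail of the local series `Σ_i κ(q^{1+i})q^{−i(1−β_j)}` -/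

/-- The terms of the local series at `e = 1` have norm `‖κ(q^{1+i})‖/q^i` (the summands of
`locK q 1`). [cite: Zhang2022LandauSiegel, §7 p.33] -/
theorem norm_localTerm_eq {q : ℕ} (hq : q.Prime) (j i : ℕ) :
    ‖Skeleton.kappaZ c' D (q ^ (1 + i)) / ((q ^ i : ℕ) : ℂ) ^ (1 - Skeleton.betaJ c' D j)‖ =
      ‖Skeleton.kappaZ c' D (q ^ (1 + i))‖ / (q : ℝ) ^ i := by
  rw [norm_div, norm_natCast_cpow_one_sub_betaJ c' D (pow_pos hq.pos i) j]
  push_cast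
  rfl

/-- The local series at `e = 1` converges absolutely. [cite: Zhang2022LandauSiegel, §7 p.33] -/
theorem summable_localTerm {q : ℕ} (hq : q.Prime) (j : ℕ) :
    Summable fun i : ℕ =>
      Skeleton.kappaZ c' D (q ^ (1 + i)) / ((q ^ i : ℕ) : ℂ) ^ (1 - Skeleton.betaJ c' D j) := by
  refine Summable.of_norm ?_
  simp_rw [norm_localTerm_eq c' D hq j]
  exact summable_locK c' D hq 1

/-- **The tail bound**: `‖Σ_{i≥0} κ(q^{1+i})q^{−i(1−β_j)} − κ(q)‖ ≤ 8S₃/q` (`S₃ =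
LogEulerProduct.tailConst 3`; the tail is dominated by `locK q 1 − ‖κ(q)‖`, `locK_le`).
[cite: Zhang2022LandauSiegel, §7 p.33] -/
theorem norm_localSeries_sub_kappa_le {q : ℕ} (hq : q.Prime) (j : ℕ) :
    ‖(∑' i : ℕ, Skeleton.kappaZ c' D (q ^ (1 + i)) / ((q ^ i : ℕ) : ℂ) ^ (1 - Skeleton.betaJ c' D j)) -
        Skeleton.kappaZ c' D q‖ ≤ 8 * LogEulerProduct.tailConst 3 / q := by
  set f : ℕ → ℂ := fun i =>
    Skeleton.kappaZ c' D (q ^ (1 + i)) / ((q ^ i : ℕ) : ℂ) ^ (1 - Skeleton.betaJ c' D j) with hf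
  have hs : Summable f := summable_localTerm c' D hq j
  have hsn : Summable fun i => ‖f i‖ := by
    simp_rw [hf, norm_localTerm_eq c' D hq j]; exact summable_locK c' D hq 1
  have h0 : f 0 = Skeleton.kappaZ c' D q := by
    simp [hf]
  have hsplit : ∑' i, f i = f 0 + ∑' i, f (i + 1) := hs.tsum_eq_zero_add
  rw [hsplit, h0, add_sub_cancel_left]
  have hsn1 : Summable fun i => ‖f (i + 1)‖ := (summable_nat_add_iff 1).mpr hsn
  -- `Σ ‖f (i+1)‖ = locK q 1 − ‖κ(q)‖ ≤ 8 S₃/q`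
  have hloc : ∑' i, ‖f i‖ = locK c' D q 1 := by
    rw [locK]; exact tsum_congr fun i => by rw [hf]; exact norm_localTerm_eq c' D hq j i
  have hsplitn : ∑' i, ‖f i‖ = ‖f 0‖ + ∑' i, ‖f (i + 1)‖ := hsn.tsum_eq_zero_add
  have hle := locK_le c' D hq 1
  rw [pow_one] at hle
  have htail : ∑' i, ‖f (i + 1)‖ ≤ 8 * LogEulerProduct.tailConst 3 / q := by
    have e8 : (((1 : ℕ) : ℝ) + 1) ^ 3 * LogEulerProduct.tailConst 3 / q =
        8 * LogEulerProduct.tailConst 3 / q := by norm_num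
    rw [h0] at hsplitn
    linarith [hloc.symm.trans hsplitn]
  exact (norm_tsum_le_tsum_norm hsn1).trans htail

/-! ### Part 4. `|ξ₀ⱼ(q;d,r)|` at a prime: the three cases -/

/-- `0 ≤ M_x := 12 + 56S₃`, the absolute constant of the `1/q` term. [folklore] -/
private theorem Mx_nonneg : (0 : ℝ) ≤ 12 + 56 * LogEulerProduct.tailConst 3 := by
  linarith [LogEulerProduct.tailConst_nonneg 3]

/-- **Case 1** (`q ∤ d`, `q ∤ r`): `‖ξ₀ⱼ(q;d,r)‖ ≤ 1 + 21B log q + M_x/q`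
(`ξ₀ⱼ(q;d,r) = λ₀ⱼ(q)·(Σ_i κ(q^{1+i})q^{−i(1−β_j)} − q^{1−β_j}/(q−1))`, `|λ₀ⱼ(q)| ≤ 1 + 12/q`,
Parts 2–3). [cite: Zhang2022LandauSiegel, §7 p.33; App. A p.102] -/
theorem norm_xiZero_prime_le_coprime {q : ℕ} (hq : q.Prime) (j : ℕ) {d r : ℕ}
    (hqd : ¬ q ∣ d) (hqr : ¬ q ∣ r) :
    ‖Skeleton.xiZero c' D j q d r‖ ≤ 1 + 21 * Bsum c' D * Real.log q + (12 + 56 * LogEulerProduct.tailConst 3) / q := by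
  have hT := LogEulerProduct.tailConst_nonneg 3
  have hB := Bsum_nonneg c' D
  have hq2 : (2 : ℝ) ≤ q := by exact_mod_cast hq.two_le
  have hqpos : (0 : ℝ) < q := by linarith
  have hlog0 : 0 ≤ Real.log q := Real.log_nonneg (by linarith)
  have hx := Lemma83.xiZero_prime_pow_of_coprime c' D j hq one_ne_zero hqd hqr
  rw [pow_one, show (1 : ℕ) - 1 = 0 from rfl] at hx
  rw [hx, norm_mul]
  -- the bracket
  set T := ∑' i : ℕ, Skeleton.kappaZ c' D (q ^ (1 + i)) /
    ((q ^ i : ℕ) : ℂ) ^ (1 - Skeleton.betaJ c' D j) with hTdef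
  set Pl := Skeleton.kappaZ c' D (q ^ 0) * (q : ℂ) ^ (1 - Skeleton.betaJ c' D j) / ((q : ℂ) - 1)
    with hPl
  have hbr : ‖T - Pl‖ ≤ 1 + 3 * Bsum c' D * Real.log q + 8 * LogEulerProduct.tailConst 3 / q := by
    have e : T - Pl = (T - Skeleton.kappaZ c' D q) + (Skeleton.kappaZ c' D q - Pl) := by ring
    rw [e]
    calc ‖(T - Skeleton.kappaZ c' D q) + (Skeleton.kappaZ c' D q - Pl)‖
        ≤ ‖T - Skeleton.kappaZ c' D q‖ + ‖Skeleton.kappaZ c' D q - Pl‖ := norm_add_le _ _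
      _ ≤ 8 * LogEulerProduct.tailConst 3 / q + (1 + 3 * Bsum c' D * Real.log q) :=
          add_le_add (norm_localSeries_sub_kappa_le c' D hq j) (norm_kappaZ_sub_pole_le c' D hq j)
      _ = _ := by ring
  have hlam : ‖Skeleton.lamZero c' D j q‖ ≤ 1 + 12 / (q : ℝ) := by
    have h := norm_lamZero_le_LamC c' D hq.ne_zero j
    rwa [LamC_apply hq.ne_zero, hq.primeFactors, prod_singleton] at h
  have hbr0 : 0 ≤ ‖T - Pl‖ := norm_nonneg _
  set x := Bsum c' D * Real.log q with hxdef
  have hx0 : 0 ≤ x := by positivity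
  have hbr' : ‖T - Pl‖ ≤ 1 + 3 * x + 8 * LogEulerProduct.tailConst 3 / q := by
    rw [hxdef]; linarith [hbr]
  have h12 : 12 / (q : ℝ) ≤ 6 := by rw [div_le_iff₀ hqpos]; linarith
  have hSq : LogEulerProduct.tailConst 3 / q ≤ LogEulerProduct.tailConst 3 / 2 :=
    div_le_div_of_nonneg_left hT two_pos hq2
  calc ‖Skeleton.lamZero c' D j q‖ * ‖T - Pl‖
      ≤ (1 + 12 / (q : ℝ)) * (1 + 3 * x + 8 * LogEulerProduct.tailConst 3 / q) :=
        mul_le_mul hlam hbr' hbr0 (by positivity)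
    _ = 1 + 3 * x + 8 * LogEulerProduct.tailConst 3 / q + 12 / q +
          12 / q * (3 * x) + 12 / q * (8 * (LogEulerProduct.tailConst 3 / q)) := by ring
    _ ≤ 1 + 3 * x + 8 * LogEulerProduct.tailConst 3 / q + 12 / q +
          6 * (3 * x) + 12 / q * (8 * (LogEulerProduct.tailConst 3 / 2)) := by gcongr
    _ = 1 + 21 * x + (12 + 56 * LogEulerProduct.tailConst 3) / q := by ring
    _ = 1 + 21 * Bsum c' D * Real.log q + (12 + 56 * LogEulerProduct.tailConst 3) / q := by
          rw [hxdef]; ring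

/-- **Case 3** (`q ∣ d`, `q ∤ r`): `‖ξ₀ⱼ(q;d,r)‖ ≤ 1 + 3B log q`
(`ξ₀ⱼ(q;d,r) = κ(q) − q^{1−β_j}/(q−1)`, Part 2). [cite: Zhang2022LandauSiegel, App. A p.103] -/
theorem norm_xiZero_prime_le_dvd_left {q : ℕ} (hq : q.Prime) (j : ℕ) {d r : ℕ}
    (hqd : q ∣ d) (hqr : ¬ q ∣ r) :
    ‖Skeleton.xiZero c' D j q d r‖ ≤ 1 + 3 * Bsum c' D * Real.log q := by
  have hx := Lemma83.xiZero_prime_pow_of_dvd_left c' D j hq one_ne_zero hqd hqr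
  rw [pow_one, show (1 : ℕ) - 1 = 0 from rfl] at hx
  rw [hx]
  exact norm_kappaZ_sub_pole_le c' D hq j

/-- **All primes `q ∤ r`**: `‖ξ₀ⱼ(q;d,r)‖ ≤ 1 + 21B log q + M_x/q` (Cases 1 and 3).
[cite: Zhang2022LandauSiegel, §7 p.33; App. A pp.102–103] -/
theorem norm_xiZero_prime_le_of_not_dvd {q : ℕ} (hq : q.Prime) (j : ℕ) {d r : ℕ}
    (hqr : ¬ q ∣ r) :
    ‖Skeleton.xiZero c' D j q d r‖ ≤ 1 + 21 * Bsum c' D * Real.log q + (12 + 56 * LogEulerProduct.tailConst 3) / q := by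
  by_cases hqd : q ∣ d
  · have hB := Bsum_nonneg c' D
    have hq2 : (2 : ℝ) ≤ q := by exact_mod_cast hq.two_le
    have hlog0 : 0 ≤ Real.log q := Real.log_nonneg (by linarith)
    have hM : 0 ≤ (12 + 56 * LogEulerProduct.tailConst 3) / (q : ℝ) := div_nonneg Mx_nonneg (by linarith)
    refine (norm_xiZero_prime_le_dvd_left c' D hq j hqd hqr).trans ?_
    nlinarith [mul_nonneg hB hlog0]
  · exact norm_xiZero_prime_le_coprime c' D hq j hqd hqr

/-- **Case 2** (`q ∣ r`): `‖ξ₀ⱼ(q;d,r)‖ = ‖κ(q)‖ ≤ 2 + B log q`.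
[cite: Zhang2022LandauSiegel, App. A p.102] -/
theorem norm_xiZero_prime_le_of_dvd {q : ℕ} (hq : q.Prime) (j : ℕ) {d r : ℕ} (hqr : q ∣ r) :
    ‖Skeleton.xiZero c' D j q d r‖ ≤ 2 + Bsum c' D * Real.log q := by
  have hx := Lemma83.xiZero_prime_pow_of_dvd_right c' D j hq one_ne_zero (d := d) hqr
  rw [pow_one] at hx
  rw [hx]
  exact norm_kappaZ_prime_le c' D hq

/-! ### Part 5. The halved majorant and the true-size logarithmic mean -/

/-- The number `ω_r(n) = #{q prime : q ∣ n, q ∣ r}` of prime factors of `n` dividing `r` is additive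
on coprime arguments. [folklore] -/
private theorem card_primeFactors_filter_dvd_mul (r : ℕ) {m n : ℕ} (hmn : Nat.Coprime m n) (hm : m ≠ 0)
    (hn : n ≠ 0) : ((m * n).primeFactors.filter (fun q => q ∣ r)).card =
      (m.primeFactors.filter (fun q => q ∣ r)).card + (n.primeFactors.filter (fun q => q ∣ r)).card := by
  rw [Nat.primeFactors_mul hm hn, filter_union,
    card_union_of_disjoint (disjoint_filter_filter hmn.disjoint_primeFactors)]

/-- `ω_r(n) ≤ ω(r)` for `r ≠ 0`. [folklore] -/
private theorem card_primeFactors_filter_dvd_le (n : ℕ) {r : ℕ} (hr : r ≠ 0) :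
    (n.primeFactors.filter (fun q => q ∣ r)).card ≤ r.primeFactors.card := by
  refine card_le_card fun q hq => ?_
  rw [mem_filter] at hq
  exact Nat.mem_primeFactors.mpr ⟨Nat.prime_of_mem_primeFactors hq.1, hq.2, hr⟩

/-- `ω_r(1) = 0`. [folklore] -/
private theorem card_primeFactors_filter_dvd_one (r : ℕ) :
    ((1 : ℕ).primeFactors.filter (fun q => q ∣ r)).card = 0 := by simp

/-- `ω_r(q) = [q ∣ r]` at a prime `q`. [folklore] -/
private theorem card_primeFactors_filter_dvd_prime (r : ℕ) {q : ℕ} (hq : q.Prime) :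
    (q.primeFactors.filter (fun p => p ∣ r)).card = if q ∣ r then 1 else 0 := by
  rw [hq.primeFactors, filter_singleton]
  split_ifs <;> simp

/-- **The true-size logarithmic mean of `ξ₀ⱼ`.** For every `c′, D, j`, `d, r ≥ 1` and `X ≥ 2`:
`Σ_{n≤X} ‖ξ₀ⱼ(n;d,r)‖/n ≤ 2^{ω(r)}·exp(4 + 21B·log(4X) + M_x + 7(2+S₃)S₄)·log X`
(`B = |b₁|+|b₂|+|b₃|`, `ω(r) = #primeFactors r`): apply `sum_div_le_gen` (`a = 1`, `K = 21B`,
`M = M_x`, `C₅ = 7(2+S₃)`, `d = 4`) to the multiplicative function `‖ξ₀ⱼ(n;d,r)‖/2^{omegaR r n}`,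
(`omegaR r n = #{q ∣ n : q ∣ r}`), whose value at a prime is `≤ 1 + 21B log q + M_x/q` by Part 4
and at prime powers `≤ gC ≤ 7(2+S₃)(ν+1)⁴`. [cite: Zhang2022LandauSiegel, §7 p.33; §11 p.64] -/
theorem sum_norm_xiZero_div_le_trueSize (j : ℕ) {d r : ℕ} (hd : d ≠ 0) (hr : r ≠ 0) {X : ℕ}
    (hX : 2 ≤ X) :
    ∑ n ∈ Icc 1 X, ‖Skeleton.xiZero c' D j n d r‖ / n ≤
      (2 : ℝ) ^ r.primeFactors.card *
        (Real.exp (4 * (1 : ℕ) + 21 * Bsum c' D * Real.log (4 * X) +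
          (12 + 56 * LogEulerProduct.tailConst 3) +
          7 * (2 + LogEulerProduct.tailConst 3) * LogEulerProduct.tailConst 4) *
            Real.log X ^ (1 : ℕ)) := by
  have hT := LogEulerProduct.tailConst_nonneg 3
  have hB := Bsum_nonneg c' D
  -- the halved majorant
  set F : ℕ → ℝ := fun n =>
    ‖Skeleton.xiZero c' D j n d r‖ / (2 : ℝ) ^ (n.primeFactors.filter (fun q => q ∣ r)).card with hF
  have hF0 : ∀ n, 0 ≤ F n := fun n => by positivity
  have hF1 : F 1 = 1 := by
    simp only [hF, Lemma83.xiZero_apply_one, card_primeFactors_filter_dvd_one, pow_zero, norm_one,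
      div_one]
  have hFle : ∀ n, F n ≤ ‖Skeleton.xiZero c' D j n d r‖ := fun n =>
    div_le_self (norm_nonneg _) (one_le_pow₀ (by norm_num))
  have hFmul : ∀ m n, Nat.Coprime m n → F (m * n) = F m * F n := by
    intro m n hmn
    rcases Nat.eq_zero_or_pos m with rfl | hm
    · simp only [Nat.coprime_zero_left] at hmn
      subst hmn
      simp [hF, Lemma83.xiZero_apply_zero]
    rcases Nat.eq_zero_or_pos n with rfl | hn
    · simp only [Nat.coprime_zero_right] at hmn
      subst hmn
      simp [hF, Lemma83.xiZero_apply_zero]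
    simp only [hF]
    rw [Lemma83.xiZero_mul_of_coprime c' D j hd hr hmn, norm_mul,
      card_primeFactors_filter_dvd_mul r hmn hm.ne' hn.ne', pow_add, mul_div_mul_comm]
  have hFpow : ∀ p ν : ℕ, p.Prime → F (p ^ ν) ≤
      7 * (2 + LogEulerProduct.tailConst 3) * ((ν : ℝ) + 1) ^ 4 := by
    intro p ν hp
    refine (hFle _).trans ((norm_xiZero_le_gC c' D (pow_ne_zero ν hp.ne_zero) j d r).trans ?_)
    exact gC_prime_pow_le c' D hp ν
  have hFsum : ∀ p, p.Prime → Summable (fun ν : ℕ => F (p ^ ν) / (p : ℝ) ^ ν) := by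
    intro p hp
    refine Summable.of_nonneg_of_le (fun ν => by positivity) (fun ν => ?_) (summable_gC_local c' D hp)
    exact div_le_div_of_nonneg_right
      ((hFle _).trans (norm_xiZero_le_gC c' D (pow_ne_zero ν hp.ne_zero) j d r)) (by positivity)
  have hFp : ∀ p, p.Prime → p ≤ X → F p ≤ (1 : ℕ) + 21 * Bsum c' D * Real.log p +
      (12 + 56 * LogEulerProduct.tailConst 3) / p := by
    intro p hp _
    have hp2 : (2 : ℝ) ≤ p := by exact_mod_cast hp.two_le
    have hlog0 : 0 ≤ Real.log p := Real.log_nonneg (by linarith)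
    have hM : 0 ≤ (12 + 56 * LogEulerProduct.tailConst 3) / (p : ℝ) := div_nonneg Mx_nonneg (by linarith)
    simp only [hF, card_primeFactors_filter_dvd_prime r hp, Nat.cast_one]
    by_cases hpr : p ∣ r
    · rw [if_pos hpr, pow_one, div_le_iff₀ (by norm_num : (0 : ℝ) < 2)]
      refine (norm_xiZero_prime_le_of_dvd c' D hp j (d := d) hpr).trans ?_
      nlinarith [mul_nonneg hB hlog0]
    · rw [if_neg hpr, pow_zero, div_one]
      exact norm_xiZero_prime_le_of_not_dvd c' D hp j (d := d) hpr
  have hmaj := sum_div_le_gen (f := F) hF1 hFmul hF0 (a := 1) (d := 4) (K := 21 * Bsum c' D)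
    (M := 12 + 56 * LogEulerProduct.tailConst 3) (C₅ := 7 * (2 + LogEulerProduct.tailConst 3))
    (by positivity) Mx_nonneg
    (by positivity) hX hFsum hFp (fun p ν hp _ => hFpow p ν hp)
  -- `‖ξ₀ⱼ(n)‖ ≤ 2^{ω(r)} F(n)`
  have hpt : ∀ n, ‖Skeleton.xiZero c' D j n d r‖ / n ≤
      (2 : ℝ) ^ r.primeFactors.card * (F n / n) := by
    intro n
    have h2 : (0 : ℝ) < (2 : ℝ) ^ (n.primeFactors.filter (fun q => q ∣ r)).card := by positivity
    have e : ‖Skeleton.xiZero c' D j n d r‖ =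
        (2 : ℝ) ^ (n.primeFactors.filter (fun q => q ∣ r)).card * F n := by
      simp only [hF]; rw [mul_div_cancel₀ _ h2.ne']
    rw [e, mul_div_assoc]
    exact mul_le_mul_of_nonneg_right
      (pow_le_pow_right₀ (by norm_num) (card_primeFactors_filter_dvd_le n hr))
      (div_nonneg (hF0 n) (Nat.cast_nonneg n))
  calc ∑ n ∈ Icc 1 X, ‖Skeleton.xiZero c' D j n d r‖ / n
      ≤ ∑ n ∈ Icc 1 X, (2 : ℝ) ^ r.primeFactors.card * (F n / n) := sum_le_sum fun n _ => hpt n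
    _ = (2 : ℝ) ^ r.primeFactors.card * ∑ n ∈ Icc 1 X, F n / n := by rw [mul_sum]
    _ ≤ _ := mul_le_mul_of_nonneg_left hmaj (by positivity)

/-! ### Part 6. The bookkeeping in `D`: `Σ_{n≤X} ‖ξ₀ⱼ(n;d,r)‖/n ≤ K_x·2^{ω(r)}·𝓛⁹` for `X ≤ 4P` -/

/-- **The true-size logarithmic mean on the range of Proposition 7.1.** For
`D ≥ ⌈exp(5|c′|π+3)⌉` (so `𝓛 ≥ 3`, `B ≤ 9π𝓛⁻⁹`), all `j`, `d, r ≥ 1` and `2 ≤ X ≤ 4P`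
(`P = exp(𝓛⁹)`; the support bound `⌈PT⁻²⌉` of (7.2) is `≤ 4P`):
`Σ_{n≤X} ‖ξ₀ⱼ(n;d,r)‖/n ≤ K_x·2^{ω(r)}·𝓛⁹`. [cite: Zhang2022LandauSiegel, §7 p.33; §11 p.64] -/
theorem sum_norm_xiZero_div_le_ell9 {c' : ℝ} {D : ℕ} (hD : ⌈Real.exp (5 * |c'| * π + 3)⌉₊ ≤ D)
    (j : ℕ) {d r : ℕ} (hd : d ≠ 0) (hr : r ≠ 0) {X : ℕ} (hX : 2 ≤ X)
    (hXP : (X : ℝ) ≤ 4 * Skeleton.bigP D) :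
    ∑ n ∈ Icc 1 X, ‖Skeleton.xiZero c' D j n d r‖ / n ≤
      3 * Real.exp (4 + 1134 * π + (12 + 56 * LogEulerProduct.tailConst 3) +
          7 * (2 + LogEulerProduct.tailConst 3) * LogEulerProduct.tailConst 4) *
        (2 : ℝ) ^ r.primeFactors.card * Skeleton.ell D ^ 9 := by
  obtain ⟨hL3, hBle⟩ := three_le_ell_and_Bsum_le hD
  set ℓ := Skeleton.ell D with hℓ
  have hℓ1 : 1 ≤ ℓ := by linarith
  have hℓ9 : (3 : ℝ) ^ 9 ≤ ℓ ^ 9 := pow_le_pow_left₀ (by norm_num) hL3 9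
  have hℓ9' : (19683 : ℝ) ≤ ℓ ^ 9 := by norm_num at hℓ9 ⊢; linarith
  have hB := Bsum_nonneg c' D
  have hX2 : (2 : ℝ) ≤ X := by exact_mod_cast hX
  have hP : Skeleton.bigP D = Real.exp (ℓ ^ 9) := rfl
  -- `log X ≤ log(4P) ≤ 3 ℓ^9` and `log(4X) ≤ log(16 P) ≤ 6 ℓ^9`
  have hlog16 : Real.log 16 ≤ 3 := by
    have : (16 : ℝ) ≤ Real.exp 3 := by
      have h27 : (2.7 : ℝ) < Real.exp 1 := lt_trans (by norm_num) Real.exp_one_gt_d9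
      have h3 : Real.exp 3 = Real.exp 1 ^ 3 := by rw [← Real.exp_nat_mul]; norm_num
      have hp : (2.7 : ℝ) ^ 3 < Real.exp 1 ^ 3 := pow_lt_pow_left₀ h27 (by norm_num) (by norm_num)
      rw [h3]; norm_num at hp; linarith
    calc Real.log 16 ≤ Real.log (Real.exp 3) := Real.log_le_log (by norm_num) this
      _ = 3 := Real.log_exp 3
  have hlog4 : Real.log 4 ≤ 3 := le_trans (Real.log_le_log (by norm_num) (by norm_num)) hlog16
  have hlogX : Real.log X ≤ 3 * ℓ ^ 9 := by
    calc Real.log X ≤ Real.log (4 * Skeleton.bigP D) := Real.log_le_log (by linarith) hXP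
      _ = Real.log 4 + ℓ ^ 9 := by
          rw [hP, Real.log_mul (by norm_num) (Real.exp_pos _).ne', Real.log_exp]
      _ ≤ 3 * ℓ ^ 9 := by linarith
  have hlog4X : Real.log (4 * X) ≤ 6 * ℓ ^ 9 := by
    have h16P : (4 : ℝ) * X ≤ 16 * Skeleton.bigP D := by linarith
    calc Real.log (4 * X) ≤ Real.log (16 * Skeleton.bigP D) := Real.log_le_log (by linarith) h16P
      _ = Real.log 16 + ℓ ^ 9 := by
          rw [hP, Real.log_mul (by norm_num) (Real.exp_pos _).ne', Real.log_exp]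
      _ ≤ 6 * ℓ ^ 9 := by linarith
  have hKlog : 21 * Bsum c' D * Real.log (4 * X) ≤ 1134 * π := by
    have hl9pos : 0 < ℓ ^ 9 := by positivity
    have hne : ℓ ^ 9 ≠ 0 := hl9pos.ne'
    have hlog4X0 : 0 ≤ Real.log (4 * X) := Real.log_nonneg (by linarith)
    calc 21 * Bsum c' D * Real.log (4 * X) ≤ 21 * (9 * π / ℓ ^ 9) * (6 * ℓ ^ 9) :=
          mul_le_mul (mul_le_mul_of_nonneg_left hBle (by norm_num)) hlog4X hlog4X0
            (by positivity)
      _ = 1134 * π := by field_simp; ring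
  have hmain := sum_norm_xiZero_div_le_trueSize c' D j hd hr hX
  have hexp : Real.exp (4 * (1 : ℕ) + 21 * Bsum c' D * Real.log (4 * X) +
          (12 + 56 * LogEulerProduct.tailConst 3) +
      7 * (2 + LogEulerProduct.tailConst 3) * LogEulerProduct.tailConst 4) ≤
      Real.exp (4 + 1134 * π + (12 + 56 * LogEulerProduct.tailConst 3) +
        7 * (2 + LogEulerProduct.tailConst 3) * LogEulerProduct.tailConst 4) := by
    apply Real.exp_le_exp.mpr
    simp only [Nat.cast_one, mul_one]
    linarith
  have hlogX0 : 0 ≤ Real.log X := Real.log_nonneg (by linarith)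
  set E := Real.exp (4 + 1134 * π + (12 + 56 * LogEulerProduct.tailConst 3) +
    7 * (2 + LogEulerProduct.tailConst 3) * LogEulerProduct.tailConst 4) with hE
  have hE0 : 0 < E := Real.exp_pos _
  calc ∑ n ∈ Icc 1 X, ‖Skeleton.xiZero c' D j n d r‖ / n
      ≤ (2 : ℝ) ^ r.primeFactors.card *
          (Real.exp (4 * (1 : ℕ) + 21 * Bsum c' D * Real.log (4 * X) +
          (12 + 56 * LogEulerProduct.tailConst 3) +
            7 * (2 + LogEulerProduct.tailConst 3) * LogEulerProduct.tailConst 4) *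
              Real.log X ^ (1 : ℕ)) := hmain
    _ ≤ (2 : ℝ) ^ r.primeFactors.card * (E * (3 * ℓ ^ 9)) := by
        rw [pow_one]
        gcongr
    _ = 3 * E * (2 : ℝ) ^ r.primeFactors.card * ℓ ^ 9 := by ring

end Literature.NumberTheory.LFunctions.Zhang2022.XiZeroMajorant

end
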